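import Summits.QuantumAdvantage.QuantumAdvantage.Theorems.CharDialTransferDialF
import Summits.QuantumAdvantage.QuantumAdvantage.Theorems.PurityDialLawL
import HarnessLib

/-!
# TransferDial M — the leaf's threshold is SHARP: SLICE-FEW FAILS at degree `2p − 2` (kernel witness)

The leaf `SliceFewTwoOdd` asks for bounded row counts at `𝔽_p`-degree `≤ 2p − 3`.  One notch UP it is FALSE at every prime: the
inner-product test `f(x, y) = [Σᵢ xᵢ yᵢ ≡ 0 (mod p)]` on `n + n` bits has `𝔽_p`-degree `≤ 2(p − 1) = 2p − 2` (one quadratic test,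
`PurityDialLaw.hasDegF_ofTests`), and for the bipartition `S =` the `x`-block its rows `y ↦ [ |A ∩ Y| ≡ 0 ]`, `A ⊆ [n]`, are pairwise
distinct (test `Y = {i}`, `i ∈ A △ A'`): `rowCount f S ≥ 2^n`.  Hence `¬ SliceFewAt p (2p − 2) R` for every `R` (`not_sliceFewAt_twoTwo`)
and the degree-`(2p − 2)` analogue `SliceFewTwoTwoOdd` of the leaf is FALSE (`not_sliceFewTwoTwoOdd`).  Together with part L (degree
`≤ p − 1`: TRUE) this brackets the open leaf (degree `≤ 2p − 3`) in kernel currency; cf. the `2p − 2` caveat of the g22/g23 memos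
(any proof of the leaf must use `d < 2(p − 1)` sharply).

Tree twin, part M of the decomp-qadv lens-6 g23 addendum.  0 sorry; no `instance`, no `notation`, no `native_decide`.
-/

set_option autoImplicit false
set_option linter.dupNamespace false

namespace Summit.QuantumAdvantage.QuantumAdvantage.Theorems.TransferDial

open Classical
open Finset
open Summit.QuantumAdvantage.AdviceFreeQNC0
open Literature.Computability.MetaComplexity Literature.Computability.MetaComplexity.Smolensky
open Summit.QuantumAdvantage.QuantumAdvantage.Theorems.PurityDialLaw (ofTests hasDegF_ofTests)

section NegTwo
variable (p : ℕ) [hp : Fact p.Prime]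

/-- The inner-product test `Σᵢ [xᵢ][yᵢ] ∈ 𝔽_p` on `n + n` bits (`xᵢ = u (castAdd i)`, `yᵢ = u (natAdd i)`). -/
def ipTest (n : ℕ) : (Fin (n + n) → Bool) → ZMod p :=
  fun u => ∑ i : Fin n, mono (ZMod p) ({Fin.castAdd n i, Fin.natAdd n i} : Finset (Fin (n + n))) u

/-- The inner-product test has degree `≤ 2`. -/
theorem ipTest_mem (n : ℕ) : ipTest p n ∈ lowDeg (ZMod p) (n + n) 2 := by
  have h : ipTest p n = ∑ i : Fin n, mono (ZMod p) ({Fin.castAdd n i, Fin.natAdd n i} : Finset (Fin (n + n))) := by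
    funext u
    rw [ipTest, Finset.sum_apply]
  rw [h]
  exact Submodule.sum_mem _ fun i _ => mono_mem_lowDeg Finset.card_le_two

/-- ★ THE WITNESS `f(x, y) = [Σᵢ xᵢ yᵢ ≡ 0 (mod p)]`. -/
def bil (n : ℕ) : (Fin (n + n) → Bool) → Bool := fun u => decide (ipTest p n u = 0)

/-- The witness has `𝔽_p`-degree `≤ 2p − 2` (one test of degree `2`, read through Fermat). -/
theorem hasDegF_bil (n : ℕ) : HasDegF p (bil p n) (2 * p - 2) := by
  have h := hasDegF_ofTests p (K := 1) (e := 2) (fun _ => ipTest p n) (fun _ => ipTest_mem p n)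
    (fun v => decide (v 0 = 0))
  have e1 : ofTests (fun _ : Fin 1 => ipTest p n) (fun v => decide (v 0 = 0)) = bil p n := by
    funext u
    rfl
  have e2 : 1 * (2 * (p - 1)) = 2 * p - 2 := by omega
  rw [e1, e2] at h
  exact h

/-- The `x`-block. -/
def xBlock (n : ℕ) : Finset (Fin (n + n)) := univ.filter fun j : Fin (n + n) => (j : ℕ) < n

/-- The input with `x = A`, `y = 0`. -/
def xVec {n : ℕ} (A : Fin n → Bool) : Fin (n + n) → Bool := Fin.append A fun _ => false

/-- The row of `x = A` evaluated at `y = e_i` reads `¬ A i`. -/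
theorem rowOf_bil_xVec_single {n : ℕ} (A : Fin n → Bool) (i : Fin n) :
    rowOf (bil p n) (xBlock n) (xVec A) (Fin.append (fun _ : Fin n => false) fun k : Fin n => decide (k = i)) = !A i := by
  -- the merged input `w`: `x`-part `A`, `y`-part `e_i`
  set w : Fin (n + n) → Bool := fun j => if j ∈ xBlock n then xVec A j
    else Fin.append (fun _ : Fin n => false) (fun k : Fin n => decide (k = i)) j with hw
  have hwx : ∀ i' : Fin n, w (Fin.castAdd n i') = A i' := by
    intro i'
    have hmem : Fin.castAdd n i' ∈ xBlock n := by
      rw [xBlock, mem_filter]; exact ⟨mem_univ _, by rw [Fin.val_castAdd]; exact i'.isLt⟩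
    rw [hw]; dsimp only; rw [if_pos hmem, xVec, Fin.append_left]
  have hwy : ∀ i' : Fin n, w (Fin.natAdd n i') = decide (i' = i) := by
    intro i'
    have hmem : Fin.natAdd n i' ∉ xBlock n := by
      rw [xBlock, mem_filter, Fin.val_natAdd]; exact fun h => by omega
    rw [hw]; dsimp only; rw [if_neg hmem, Fin.append_right]
  have hip : ipTest p n w = if A i = true then 1 else 0 := by
    rw [ipTest, Finset.sum_eq_single i]
    · rw [mono_apply]
      simp only [mem_insert, mem_singleton, forall_eq_or_imp, forall_eq, hwx, hwy, decide_true, and_true]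
    · intro i' _ hne
      rw [mono_apply, if_neg]
      intro hall
      have := hall (Fin.natAdd n i') (by simp)
      rw [hwy] at this
      exact hne (of_decide_eq_true this)
    · intro h; exact absurd (mem_univ i) h
  show bil p n w = !A i
  rw [bil, hip]
  cases A i
  · simp
  · simp [one_ne_zero]

/-- Distinct `x`-parts give distinct rows: the row map is injective on `{xVec A}`. -/
theorem rowOf_bil_injective (n : ℕ) : Function.Injective fun A : Fin n → Bool => rowOf (bil p n) (xBlock n) (xVec A) := by
  intro A A' h
  funext i
  have h1 := congrFun h (Fin.append (fun _ : Fin n => false) fun k : Fin n => decide (k = i))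
  dsimp only at h1
  rw [rowOf_bil_xVec_single, rowOf_bil_xVec_single] at h1
  cases hA : A i <;> cases hA' : A' i <;> simp_all

/-- The `x`-block of the witness has `≥ 2^n` rows. -/
theorem two_pow_le_rowCount_bil (n : ℕ) : 2 ^ n ≤ rowCount (bil p n) (xBlock n) := by
  have hsub : (univ : Finset (Fin n → Bool)).image (fun A => rowOf (bil p n) (xBlock n) (xVec A)) ⊆
      (univ : Finset (Fin (n + n) → Bool)).image (rowOf (bil p n) (xBlock n)) := by
    intro g hg
    rw [mem_image] at hg ⊢
    obtain ⟨A, -, rfl⟩ := hg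
    exact ⟨xVec A, mem_univ _, rfl⟩
  calc 2 ^ n = ((univ : Finset (Fin n → Bool)).image fun A => rowOf (bil p n) (xBlock n) (xVec A)).card := by
        rw [card_image_of_injective _ (rowOf_bil_injective p n), card_univ, Fintype.card_fun, Fintype.card_bool,
          Fintype.card_fin]
    _ ≤ _ := by rw [rowCount]; exact card_le_card hsub

/-- ★★ SLICE-FEW FAILS AT DEGREE `2p − 2`: no row budget works (witness `bil p R`, `x`-block, `2^R > R` rows). -/
theorem not_sliceFewAt_twoTwo (R : ℕ) : ¬ SliceFewAt p (2 * p - 2) R := by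
  intro h
  have h1 := h (R + R) (bil p R) (hasDegF_bil p R) (xBlock R)
  have h2 := two_pow_le_rowCount_bil p R
  have h3 : R < 2 ^ R := Nat.lt_two_pow_self
  omega

end NegTwo

/-- The degree-`(2p − 2)` analogue of the leaf `SliceFewTwoOdd` (same shape, degree `2p − 2` in place of `2p − 3`). -/
def SliceFewTwoTwoOdd : Prop := ∀ (p : ℕ) [Fact p.Prime], 5 ≤ p → ∃ R : ℕ, SliceFewAt p (2 * p - 2) R

/-- ★★ It is FALSE (already at `p = 5`): the leaf's degree threshold `2p − 3` is sharp. -/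
theorem not_sliceFewTwoTwoOdd : ¬ SliceFewTwoTwoOdd := by
  intro h
  haveI : Fact (Nat.Prime 5) := ⟨by norm_num⟩
  obtain ⟨R, hR⟩ := h 5 (le_refl 5)
  exact not_sliceFewAt_twoTwo 5 R hR

/-- info: 'Summit.QuantumAdvantage.QuantumAdvantage.Theorems.TransferDial.not_sliceFewTwoTwoOdd' depends on axioms: [propext,
 choice,
 Quot.sound] -/
#guard_msgs in #print axioms not_sliceFewTwoTwoOdd

end Summit.QuantumAdvantage.QuantumAdvantage.Theorems.TransferDial
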